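import Summits.BirchSwinnertonDyer.BirchSwinnertonDyer.Theorems.BiquadraticEisensteinDescentHeegnerTwistCouplingInSupplySymbolicMonskyOddKernelParity
import HarnessLib

set_option linter.dupNamespace false -- `Summit.BirchSwinnertonDyer.BirchSwinnertonDyer.Theorems.…` (summit = sub)
set_option autoImplicit false

/-!
# Crux `HeegnerTwistCouplingInSupply` (stmt-BirchSwinnertonDyer-21381) — ODD UNIVERSALITY ON THE FAMILY `(2/P_b) = +1`: every odd base
# `P₀⋯P_k ≡ 7 (mod 8)` with all `P_b ≡ ±1 (mod 8)` owns a pattern-free Heegner recipe at `t₀` via `δ = 1` — all odd μ, no exceptional class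

Route `BiquadraticEisensteinDescent` (cell `pub/bsd-wall`, width seat `bsd-wall-cm-bed-w3` g24; `--supports` 21381, helper). The ODD twin of
`…SymbolicMonskyEvenDesignNegTwoTrivial` (p752709). THEOREM B (p745248, w3 g23) settles every odd base with μ = 1; for odd μ ≥ 3 («THEOREM C»,
memo THEOREM-B-w3g23 §3) the one-stage door has an exceptional class `κ_u + ε > τ₀` (memo THEOREM-A-w3g22). This file proves that on the family
where `2` is a square modulo every base prime — all `P_b ≡ ±1 (mod 8)`, μ odd (so `n₀ ≡ 7 (mod 8)`, root number `−1`) — there is NO exceptional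
class: the single design `δ = 1` works for every base, every `k`, EVERY odd μ.
* ★ `mem_virtualKernel_iff_of_negTwo_false` — `(x, y) ∈ 𝒦 ⟺ Lᵀx = 0 ∧ ⟨m, x⟩ = 0 ∧ L(x + y) = 0` (`L` the Laplacian, `Lᵀ` by reciprocity; the middle
  condition is forced by the column sums `(1+μ)m = 0` of `L`);
* ★★★ `exists_patternFree_design_of_negTwo_false_odd` — cells `c₁ :: rest`, `|rest| = τ₀ = (dim 𝒦 + 1)/2`, `heegnerK`, `det M_odd = 1` for every
  mutual pattern. Proof: `dim 𝒦 ≥ 2 dim ker L − 1` (pairs `(0,y)`, `y ∈ ker L`, and `(x,x)`, `x ∈ ker Lᵀ ∩ m^⊥`; `rank L = rank Lᵀ`); the three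
  sections of `𝒦⁺(1) = 𝒦 ⊕ ⟨(1,1)⟩` lie in `ker L × 0`, `0 × ker L`, `{(x,x) : x ∈ ker Lᵀ}`; `(1,1) ∉ 𝒦` as `⟨m,1⟩ = 1`; `hdim` by the kernel parity
  (`exists_patternFree_design_of_odd`, p752042).
Numerics (memo EVEN-EXCEPTIONAL-CLASS-w3g24 §2c): 22 117 sampled bases of the family (`K ≤ 9`, μ = 1, 3, 5, 7): δ = 1 good in all.

HONEST FRAMING: RUNG-LEVEL corner layer (odd congruent `j = 1728` families `E_{n₀}`); an existence theorem about Monsky matrices — instances of the crux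
still need located primes (`RealisesK.cruxOn_odd_of_BT_of_forall`) and the print input (Burungale–Tian); the crux as stated (C⁺), its registered
stubs and BSD are NOT touched; nothing is closed. THEOREMS ONLY (no `def`, no instance, no notation).
Reference: [HeathBrown1994] D. R. Heath-Brown, Invent. Math. 118 (1994) 331–370, appendix (Monsky), typescript pp. 39–41.
-/

namespace Summit.BirchSwinnertonDyer.BirchSwinnertonDyer.Theorems.SymbolicMonsky

section OddNegTwoTrivial

open Module Matrix

variable {k : ℕ} (base : SymbData (k + 1))

/-- Row of the Laplacian block: `(L y)_i = Σ_j [(P_j/P_i) = −1](y_j + y_i)`. -/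
private theorem lapO_mulVec (y : Fin (k + 1) → ZMod 2) (i : Fin (k + 1)) :
    ((Matrix.of fun i j : Fin (k + 1) => bz (base.neg i j) + if i = j then (∑ l, bz (base.neg i l)) else 0) *ᵥ y) i =
      ∑ j, bz (base.neg i j) * (y j + y i) := by
  simp only [mulVec, dotProduct, Matrix.of_apply]
  have e1 : (∑ j, (bz (base.neg i j) + if i = j then (∑ l, bz (base.neg i l)) else 0) * y j) =
      (∑ j, bz (base.neg i j) * y j) + ∑ j, (if i = j then (∑ l, bz (base.neg i l)) * y j else 0) := by
    rw [← Finset.sum_add_distrib]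
    refine Finset.sum_congr rfl fun j _ => ?_
    split_ifs <;> ring
  have e2 : (∑ j, bz (base.neg i j) * (y j + y i)) = (∑ j, bz (base.neg i j) * y j) + (∑ l, bz (base.neg i l)) * y i := by
    rw [Finset.sum_mul, ← Finset.sum_add_distrib]
    exact Finset.sum_congr rfl fun j _ => by ring
  rw [e1, Finset.sum_ite_eq, e2]
  simp only [Finset.mem_univ, if_true]

/-- Row of the transposed Laplacian (quadratic reciprocity): `(Lᵀ x)_i = Σ_j [(P_j/P_i) = −1](x_j + x_i) + m_i ⟨m,x⟩ + m_i x_i`. -/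
private theorem lapOT_mulVec (x : Fin (k + 1) → ZMod 2) (i : Fin (k + 1)) :
    ((Matrix.of fun i j : Fin (k + 1) => bz (base.neg i j) + if i = j then (∑ l, bz (base.neg i l)) else 0)ᵀ *ᵥ x) i =
      (∑ j, bz (base.neg i j) * (x j + x i)) + bz (negNegOne (base.cls i)) * (∑ j, bz (negNegOne (base.cls j)) * x j) +
        bz (negNegOne (base.cls i)) * x i := by
  have h2 : ∀ x : ZMod 2, x + x = 0 := by decide
  have hsq : ∀ x : ZMod 2, x * x = x := by decide
  simp only [mulVec, dotProduct, transpose_apply, Matrix.of_apply]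
  have hpt : ∀ j, (bz (base.neg j i) + if j = i then (∑ l, bz (base.neg j l)) else 0) * x j =
      bz (base.neg i j) * x j + bz (negNegOne (base.cls i)) * bz (negNegOne (base.cls j)) * x j +
        (if j = i then ((∑ l, bz (base.neg i l)) + bz (negNegOne (base.cls i))) * x j else 0) := by
    intro j
    by_cases hji : j = i
    · subst hji
      rw [if_pos rfl, if_pos rfl]
      linear_combination (-(hsq (bz (negNegOne (base.cls j)))) - h2 (bz (negNegOne (base.cls j)))) * x j
    · have hij : i ≠ j := fun h => hji h.symm
      rw [if_neg hji, if_neg hji, base.bz_neg_swap hij, bz_and_mul]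
      ring
  rw [Finset.sum_congr rfl fun j _ => hpt j, Finset.sum_add_distrib, Finset.sum_add_distrib, Finset.sum_ite_eq' Finset.univ i]
  simp only [Finset.mem_univ, if_true]
  have e2 : (∑ j, bz (base.neg i j) * (x j + x i)) = (∑ j, bz (base.neg i j) * x j) + (∑ l, bz (base.neg i l)) * x i := by
    rw [Finset.sum_mul, ← Finset.sum_add_distrib]
    exact Finset.sum_congr rfl fun j _ => by ring
  have e3 : (∑ j, bz (negNegOne (base.cls i)) * bz (negNegOne (base.cls j)) * x j) =
      bz (negNegOne (base.cls i)) * ∑ j, bz (negNegOne (base.cls j)) * x j := by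
    rw [Finset.mul_sum]
    exact Finset.sum_congr rfl fun j _ => by ring
  rw [e2, e3]
  ring

/-- Column sums of the Laplacian: `Σ_i Σ_j [(P_j/P_i) = −1](y_j + y_i) = (1 + μ)⟨m,y⟩`. -/
private theorem sum_lapO_eq (y : Fin (k + 1) → ZMod 2) :
    (∑ i, ∑ j, bz (base.neg i j) * (y j + y i)) =
      (1 + ∑ b, bz (negNegOne (base.cls b))) * ∑ j, bz (negNegOne (base.cls j)) * y j := by
  have h2 : ∀ x : ZMod 2, x + x = 0 := by decide
  have hsq : ∀ x : ZMod 2, x * x = x := by decide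
  have e1 : (∑ i, ∑ j, bz (base.neg i j) * (y j + y i)) = ∑ i, ∑ j, (bz (base.neg j i) + bz (base.neg i j)) * y i := by
    have : (∑ i, ∑ j, bz (base.neg i j) * (y j + y i)) = (∑ i, ∑ j, bz (base.neg i j) * y j) + ∑ i, ∑ j, bz (base.neg i j) * y i := by
      rw [← Finset.sum_add_distrib]
      refine Finset.sum_congr rfl fun i _ => ?_
      rw [← Finset.sum_add_distrib]
      exact Finset.sum_congr rfl fun j _ => by ring
    rw [this, Finset.sum_comm, ← Finset.sum_add_distrib]
    refine Finset.sum_congr rfl fun i _ => ?_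
    rw [← Finset.sum_add_distrib]
    exact Finset.sum_congr rfl fun j _ => by ring
  have e2 : ∀ i, (∑ j, (bz (base.neg j i) + bz (base.neg i j)) * y i) =
      (∑ j, bz (negNegOne (base.cls i)) * bz (negNegOne (base.cls j)) * y i) + bz (negNegOne (base.cls i)) * y i := by
    intro i
    have hpt : ∀ j, (bz (base.neg j i) + bz (base.neg i j)) * y i =
        bz (negNegOne (base.cls i)) * bz (negNegOne (base.cls j)) * y i + (if j = i then bz (negNegOne (base.cls i)) * y i else 0) := by
      intro j
      by_cases hji : j = i
      · subst hji
        rw [if_pos rfl]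
        linear_combination (h2 (bz (base.neg j j))) * y j - (hsq (bz (negNegOne (base.cls j)))) * y j -
          h2 (bz (negNegOne (base.cls j)) * y j)
      · have hij : i ≠ j := fun h => hji h.symm
        rw [if_neg hji, base.bz_neg_swap hij, bz_and_mul]
        linear_combination (h2 (bz (base.neg i j))) * y i
    rw [Finset.sum_congr rfl fun j _ => hpt j, Finset.sum_add_distrib, Finset.sum_ite_eq' Finset.univ i]
    simp only [Finset.mem_univ, if_true]
  rw [e1, Finset.sum_congr rfl fun i _ => e2 i, Finset.sum_add_distrib, add_mul, one_mul, Finset.mul_sum]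
  have e3 : ∀ i, (∑ j, bz (negNegOne (base.cls i)) * bz (negNegOne (base.cls j)) * y i) =
      (∑ b, bz (negNegOne (base.cls b))) * (bz (negNegOne (base.cls i)) * y i) := by
    intro i
    rw [Finset.sum_mul]
    exact Finset.sum_congr rfl fun j _ => by ring
  rw [Finset.sum_congr rfl fun i _ => e3 i, add_comm]

/-- ★ **The (odd) virtual kernel when every base prime is `≡ ±1 (mod 8)` and μ is odd**:
`(x, y) ∈ 𝒦 ⟺ Lᵀx = 0 ∧ ⟨m, x⟩ = 0 ∧ L(x + y) = 0`. -/
theorem mem_virtualKernel_iff_of_negTwo_false (hd : ∀ b, negTwo (base.cls b) = false)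
    (hμ : (∑ b, bz (negNegOne (base.cls b))) = 1) (p : (Fin (k + 1) → ZMod 2) × (Fin (k + 1) → ZMod 2)) :
    p ∈ base.virtualKernel ↔
      ((∀ i, (∑ j, bz (base.neg i j) * (p.1 j + p.1 i)) + bz (negNegOne (base.cls i)) * (∑ j, bz (negNegOne (base.cls j)) * p.1 j) +
          bz (negNegOne (base.cls i)) * p.1 i = 0) ∧
       ((∑ j, bz (negNegOne (base.cls j)) * p.1 j) = 0) ∧
       (∀ i, (∑ j, bz (base.neg i j) * (p.1 j + p.1 i)) + ∑ j, bz (base.neg i j) * (p.2 j + p.2 i) = 0)) := by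
  have h2 : ∀ x : ZMod 2, x + x = 0 := by decide
  have hd0 : ∀ b, bz (negTwo (base.cls b)) = 0 := fun b => by rw [hd b]; rfl
  rw [mem_virtualKernel_iff]
  simp only [hd0, zero_mul, add_zero]
  constructor
  · rintro ⟨hE1, hE2⟩
    have hs : (∑ i, (bz (negNegOne (base.cls i)) * p.1 i + ∑ j, bz (base.neg i j) * (p.2 j + p.2 i))) = 0 :=
      Finset.sum_eq_zero fun i _ => hE2 i
    rw [Finset.sum_add_distrib, sum_lapO_eq, hμ] at hs
    have hM : (∑ j, bz (negNegOne (base.cls j)) * p.1 j) = 0 := by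
      linear_combination hs - h2 (∑ j, bz (negNegOne (base.cls j)) * p.2 j)
    refine ⟨fun i => ?_, hM, fun i => ?_⟩
    · have e1 := hE1 i
      linear_combination e1 + bz (negNegOne (base.cls i)) * hM
    · have e1 := hE1 i
      have e2 := hE2 i
      linear_combination e1 + e2 - h2 (bz (negNegOne (base.cls i)) * p.1 i)
  · rintro ⟨hT, hM, hL⟩
    refine ⟨fun i => ?_, fun i => ?_⟩
    · have e := hT i
      linear_combination e - bz (negNegOne (base.cls i)) * hM
    · have e := hT i
      have e' := hL i
      linear_combination e' - e + bz (negNegOne (base.cls i)) * hM + h2 (bz (negNegOne (base.cls i)) * p.1 i)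

/-- ★★★ **ODD UNIVERSALITY ON THE FAMILY `(2/P_b) = +1` — a hypothesis-free slice of THEOREM C.** Let `n₀ = P₀⋯P_k` be ODD with EVERY
`P_b ≡ ±1 (mod 8)` and an odd number of `P_b ≡ 7 (mod 8)` (`n₀ ≡ 7 (mod 8)`, root number `−1`; μ = 1, 3, 5, … all allowed). Then the design
`δ = 1` satisfies ALL hypotheses of THEOREM A (`exists_patternFree_design`, p742384): there are cells `c₁ :: rest`, `|rest| = τ₀ = (dim 𝒦 + 1)/2`,
with `heegnerK` and Monsky's ODD matrix invertible for EVERY mutual pattern — a pattern-free Heegner recipe with `τ₀ + 1` auxiliary primes. For μ = 1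
this is contained in THEOREM B (p745248); for odd μ ≥ 3 it is NEW (memo THEOREM-B-w3g23 §3 «THEOREM C» restricted to this family, with no
exceptional class). Proof: `𝒦 = {(x,y) : x ∈ ker Lᵀ ∩ m^⊥, x + y ∈ ker L}` (`mem_virtualKernel_iff_of_negTwo_false`), so `dim 𝒦 ≥ 2 dim ker L − 1`
(pairs `(0,y)`, `y ∈ ker L`, and `(x,x)`, `x ∈ ker Lᵀ ∩ m^⊥`; `rank L = rank Lᵀ`); for `δ = 1` the sections of `𝒦⁺ = 𝒦 ⊕ ⟨(1,1)⟩` lie in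
`ker L × 0`, `0 × ker L`, `{(x,x) : x ∈ ker Lᵀ}`; legitimacy from `⟨m,1⟩ = μ = 1`; the dimension hypothesis by `odd_finrank_virtualKernel` (p752042).
[cite: HeathBrown1994SelmerCongruentII, Appendix (Monsky), typescript pp. 39–41] -/
theorem exists_patternFree_design_of_negTwo_false_odd (hd : ∀ b, negTwo (base.cls b) = false)
    (hμ : (∑ b, bz (negNegOne (base.cls b))) = 1) :
    ∃ (c₁ : AuxCell) (rest : List AuxCell), rest.length = (finrank (ZMod 2) ↥base.virtualKernel + 1) / 2 ∧
      heegnerK base (c₁ :: rest) = true ∧ ∀ pat : ℕ → ℕ → Bool, (dataK base (c₁ :: rest) pat).monskyOddS.det = 1 := by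
  have h2 : ∀ x : ZMod 2, x + x = 0 := by decide
  have hd0 : ∀ b, bz (negTwo (base.cls b)) = 0 := fun b => by rw [hd b]; rfl
  have hroot : (∑ b, (bz (negNegOne (base.cls b)) + bz (negTwo (base.cls b)))) = 1 := by
    rw [Finset.sum_add_distrib, hμ]; simp [hd0]
  -- the Laplacian and its transpose
  set Lm : Matrix (Fin (k + 1)) (Fin (k + 1)) (ZMod 2) := Matrix.of fun i j : Fin (k + 1) => bz (base.neg i j) +
      if i = j then (∑ l, bz (base.neg i l)) else 0 with hLm
  set kerL : Submodule (ZMod 2) (Fin (k + 1) → ZMod 2) := LinearMap.ker Lm.mulVecLin with hkerL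
  set kerLt : Submodule (ZMod 2) (Fin (k + 1) → ZMod 2) := LinearMap.ker Lmᵀ.mulVecLin with hkerLt
  have memL : ∀ y, y ∈ kerL ↔ ∀ i, (∑ j, bz (base.neg i j) * (y j + y i)) = 0 := by
    intro y
    rw [hkerL, LinearMap.mem_ker, mulVecLin_apply]
    constructor
    · intro h i; have := congrFun h i; rwa [lapO_mulVec] at this
    · intro h; funext i; rw [lapO_mulVec]; exact h i
  have memLt : ∀ x, x ∈ kerLt ↔ ∀ i, (∑ j, bz (base.neg i j) * (x j + x i)) +
      bz (negNegOne (base.cls i)) * (∑ j, bz (negNegOne (base.cls j)) * x j) + bz (negNegOne (base.cls i)) * x i = 0 := by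
    intro x
    rw [hkerLt, LinearMap.mem_ker, mulVecLin_apply]
    constructor
    · intro h i; have := congrFun h i; rwa [lapOT_mulVec] at this
    · intro h; funext i; rw [lapOT_mulVec]; exact h i
  have hrank : finrank (ZMod 2) ↥kerLt = finrank (ZMod 2) ↥kerL := by
    have r1 := LinearMap.finrank_range_add_finrank_ker Lm.mulVecLin
    have r2 := LinearMap.finrank_range_add_finrank_ker Lmᵀ.mulVecLin
    have rt : Lmᵀ.rank = Lm.rank := rank_transpose Lm
    change Lmᵀ.rank + _ = _ at r2
    change Lm.rank + _ = _ at r1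
    rw [hkerLt, hkerL]
    omega
  set t := finrank (ZMod 2) ↥kerL with ht
  -- the functional `⟨m, ·⟩`
  let φ : (Fin (k + 1) → ZMod 2) →ₗ[ZMod 2] ZMod 2 := ∑ j, bz (negNegOne (base.cls j)) • LinearMap.proj j
  have hφ : ∀ u, φ u = ∑ j, bz (negNegOne (base.cls j)) * u j := by
    intro u
    simp only [φ, LinearMap.coe_sum, Finset.sum_apply, LinearMap.smul_apply, LinearMap.coe_proj, Function.eval, smul_eq_mul]
  have hφ1 : φ (fun _ => 1) = 1 := by rw [hφ]; simpa using hμ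
  have h1Lt : (fun _ => (1 : ZMod 2)) ∈ kerLt := by
    rw [memLt]; intro i
    simp only [h2, mul_zero, Finset.sum_const_zero, zero_add, mul_one, hμ]
  -- LOWER BOUND `2t ≤ dim 𝒦 + 1`
  have hlow : 2 * t ≤ finrank (ZMod 2) ↥base.virtualKernel + 1 := by
    set H := kerL.map (LinearMap.inr (ZMod 2) (Fin (k + 1) → ZMod 2) (Fin (k + 1) → ZMod 2)) with hH
    set D := (kerLt ⊓ LinearMap.ker φ).map ((LinearMap.id : (Fin (k + 1) → ZMod 2) →ₗ[ZMod 2] (Fin (k + 1) → ZMod 2)).prod LinearMap.id)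
      with hD
    have hHle : H ≤ base.virtualKernel := by
      rintro p hp
      obtain ⟨y, hy, rfl⟩ := Submodule.mem_map.1 hp
      rw [memL] at hy
      rw [mem_virtualKernel_iff_of_negTwo_false base hd hμ]
      refine ⟨fun i => ?_, ?_, fun i => ?_⟩
      · simp only [LinearMap.inr_apply, Pi.zero_apply, add_zero, mul_zero, Finset.sum_const_zero]
      · simp only [LinearMap.inr_apply, Pi.zero_apply, mul_zero, Finset.sum_const_zero]
      · simp only [LinearMap.inr_apply, Pi.zero_apply, add_zero, mul_zero, Finset.sum_const_zero, zero_add]; exact hy i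
    have hDle : D ≤ base.virtualKernel := by
      rintro p hp
      obtain ⟨x, hx, rfl⟩ := Submodule.mem_map.1 hp
      obtain ⟨hxL, hxφ⟩ := Submodule.mem_inf.1 hx
      rw [memLt] at hxL
      rw [LinearMap.mem_ker, hφ] at hxφ
      rw [mem_virtualKernel_iff_of_negTwo_false base hd hμ]
      refine ⟨fun i => ?_, ?_, fun i => ?_⟩
      · simp only [LinearMap.prod_apply, LinearMap.id_coe]; exact hxL i
      · simp only [LinearMap.prod_apply, LinearMap.id_coe]; exact hxφ
      · simp only [LinearMap.prod_apply, LinearMap.id_coe]; exact h2 _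
    have hHD : H ⊓ D = ⊥ := by
      rw [Submodule.eq_bot_iff]
      intro p hp
      obtain ⟨hpH, hpD⟩ := Submodule.mem_inf.1 hp
      obtain ⟨y, -, rfl⟩ := Submodule.mem_map.1 hpH
      obtain ⟨x, -, hx⟩ := Submodule.mem_map.1 hpD
      have h0 : x = 0 := by have := congrArg Prod.fst hx; simpa using this
      have h1 : x = y := by have := congrArg Prod.snd hx; simpa using this
      rw [← h1, h0]; rfl
    have hsum : finrank (ZMod 2) ↥(H ⊔ D) = finrank (ZMod 2) ↥H + finrank (ZMod 2) ↥D := by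
      have := Submodule.finrank_sup_add_finrank_inf_eq H D
      rw [hHD, finrank_bot, add_zero] at this
      exact this
    have hHfin : finrank (ZMod 2) ↥H = finrank (ZMod 2) ↥kerL :=
      (LinearEquiv.finrank_eq (Submodule.equivMapOfInjective _ LinearMap.inr_injective _)).symm
    have hinjD : Function.Injective ((LinearMap.id : (Fin (k + 1) → ZMod 2) →ₗ[ZMod 2] (Fin (k + 1) → ZMod 2)).prod LinearMap.id) :=
      fun a b hab => congrArg Prod.fst hab
    have hDfin : finrank (ZMod 2) ↥D = finrank (ZMod 2) ↥(kerLt ⊓ LinearMap.ker φ) :=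
      (LinearEquiv.finrank_eq (Submodule.equivMapOfInjective _ hinjD _)).symm
    have hcod : finrank (ZMod 2) ↥kerLt ≤ finrank (ZMod 2) ↥(kerLt ⊓ LinearMap.ker φ) + 1 := by
      have hle : kerLt ≤ (kerLt ⊓ LinearMap.ker φ) ⊔ Submodule.span (ZMod 2) {fun _ => (1 : ZMod 2)} := by
        intro x hx
        rw [Submodule.mem_sup]
        refine ⟨x - φ x • (fun _ => (1 : ZMod 2)), Submodule.mem_inf.2 ⟨?_, ?_⟩, φ x • (fun _ => (1 : ZMod 2)),
          Submodule.mem_span_singleton.2 ⟨φ x, rfl⟩, by abel⟩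
        · exact kerLt.sub_mem hx (kerLt.smul_mem _ h1Lt)
        · rw [LinearMap.mem_ker, map_sub, map_smul, hφ1, smul_eq_mul, mul_one, sub_self]
      calc finrank (ZMod 2) ↥kerLt ≤ finrank (ZMod 2) ↥((kerLt ⊓ LinearMap.ker φ) ⊔ Submodule.span (ZMod 2) {fun _ => (1 : ZMod 2)}) :=
            Submodule.finrank_mono hle
        _ ≤ finrank (ZMod 2) ↥(kerLt ⊓ LinearMap.ker φ) + finrank (ZMod 2) ↥(Submodule.span (ZMod 2) {fun _ => (1 : ZMod 2)}) :=
            Submodule.finrank_add_le_finrank_add_finrank _ _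
        _ ≤ finrank (ZMod 2) ↥(kerLt ⊓ LinearMap.ker φ) + 1 := by
            have h1ne : (fun _ => (1 : ZMod 2)) ≠ (0 : Fin (k + 1) → ZMod 2) := by
              intro h; have := congrFun h 0; simp at this
            rw [finrank_span_singleton h1ne]
    have hle : finrank (ZMod 2) ↥(H ⊔ D) ≤ finrank (ZMod 2) ↥base.virtualKernel := Submodule.finrank_mono (sup_le hHle hDle)
    rw [hsum, hHfin, hDfin] at hle
    omega
  have htτ : t ≤ (finrank (ZMod 2) ↥base.virtualKernel + 1) / 2 := by omega
  -- the design `δ = 1`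
  set δ : Fin (k + 1) → ZMod 2 := fun _ => 1 with hδdef
  have haug : ∀ p : (Fin (k + 1) → ZMod 2) × (Fin (k + 1) → ZMod 2), p ∈ base.augKernel δ →
      ∃ (x y : Fin (k + 1) → ZMod 2) (γ : ZMod 2),
        ((∀ i, (∑ j, bz (base.neg i j) * (x j + x i)) + bz (negNegOne (base.cls i)) * (∑ j, bz (negNegOne (base.cls j)) * x j) +
            bz (negNegOne (base.cls i)) * x i = 0) ∧
         ((∑ j, bz (negNegOne (base.cls j)) * x j) = 0) ∧
         (∀ i, (∑ j, bz (base.neg i j) * (x j + x i)) + ∑ j, bz (base.neg i j) * (y j + y i) = 0)) ∧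
        p = (fun b => x b + γ, fun b => y b + γ) := by
    intro p hp
    obtain ⟨q, hq, γ, rfl⟩ := exists_of_mem_augKernel base δ hp
    refine ⟨q.1, q.2, γ, (mem_virtualKernel_iff_of_negTwo_false base hd hμ q).1 hq, ?_⟩
    refine Prod.ext ?_ ?_
    · funext b; simp [hδdef]
    · funext b; simp [hδdef]
  have hleg : ((δ, fun _ => (1 : ZMod 2)) : (Fin (k + 1) → ZMod 2) × (Fin (k + 1) → ZMod 2)) ∉ base.virtualKernel := by
    intro h
    have := ((mem_virtualKernel_iff_of_negTwo_false base hd hμ _).1 h).2.1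
    simp only [hδdef, mul_one] at this
    rw [hμ] at this
    exact one_ne_zero this
  -- (h1)
  have hP1 : base.augKernel δ ⊓ LinearMap.ker (LinearMap.snd (ZMod 2) (Fin (k + 1) → ZMod 2) (Fin (k + 1) → ZMod 2)) ≤
      kerL.map (LinearMap.inl (ZMod 2) (Fin (k + 1) → ZMod 2) (Fin (k + 1) → ZMod 2)) := by
    intro p hp
    obtain ⟨hpW, hp0⟩ := Submodule.mem_inf.1 hp
    obtain ⟨x, y, γ, ⟨hT, hM, hL⟩, rfl⟩ := haug p hpW
    rw [LinearMap.mem_ker, LinearMap.snd_apply] at hp0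
    have hy : ∀ b, y b = γ := fun b => by
      have := congrFun hp0 b; simp only [Pi.zero_apply] at this
      linear_combination this - h2 γ
    refine Submodule.mem_map.2 ⟨fun b => x b + γ, ?_, ?_⟩
    · rw [memL]; intro i
      have e := hL i
      simp only [hy, h2, mul_zero, Finset.sum_const_zero, add_zero] at e
      rw [← e]; exact Finset.sum_congr rfl fun j _ => by linear_combination (bz (base.neg i j)) * h2 γ
    · refine Prod.ext rfl ?_
      funext b; simp [hy b, h2]
  -- (h2)
  have hP2 : base.augKernel δ ⊓ LinearMap.ker (LinearMap.fst (ZMod 2) (Fin (k + 1) → ZMod 2) (Fin (k + 1) → ZMod 2)) ≤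
      kerL.map (LinearMap.inr (ZMod 2) (Fin (k + 1) → ZMod 2) (Fin (k + 1) → ZMod 2)) := by
    intro p hp
    obtain ⟨hpW, hp0⟩ := Submodule.mem_inf.1 hp
    obtain ⟨x, y, γ, ⟨hT, hM, hL⟩, rfl⟩ := haug p hpW
    rw [LinearMap.mem_ker, LinearMap.fst_apply] at hp0
    have hx : ∀ b, x b = γ := fun b => by
      have := congrFun hp0 b; simp only [Pi.zero_apply] at this
      linear_combination this - h2 γ
    have hγ : γ = 0 := by
      have e := hM
      simp only [hx] at e
      rw [← Finset.sum_mul, hμ, one_mul] at e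
      exact e
    refine Submodule.mem_map.2 ⟨y, ?_, ?_⟩
    · rw [memL]; intro i
      have e := hL i
      simp only [hx, h2, mul_zero, Finset.sum_const_zero, zero_add] at e
      exact e
    · refine Prod.ext ?_ ?_
      · funext b; simp [hx b, hγ]
      · funext b; simp [hγ]
  -- (h3)
  have hP3 : base.augKernel δ ⊓ LinearMap.ker (LinearMap.fst (ZMod 2) (Fin (k + 1) → ZMod 2) (Fin (k + 1) → ZMod 2) +
      LinearMap.snd (ZMod 2) (Fin (k + 1) → ZMod 2) (Fin (k + 1) → ZMod 2)) ≤
      kerLt.map ((LinearMap.id : (Fin (k + 1) → ZMod 2) →ₗ[ZMod 2] (Fin (k + 1) → ZMod 2)).prod LinearMap.id) := by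
    intro p hp
    obtain ⟨hpW, hp0⟩ := Submodule.mem_inf.1 hp
    obtain ⟨x, y, γ, ⟨hT, hM, hL⟩, rfl⟩ := haug p hpW
    rw [LinearMap.mem_ker, LinearMap.add_apply, LinearMap.fst_apply, LinearMap.snd_apply] at hp0
    have hxy : ∀ b, y b = x b := fun b => by
      have := congrFun hp0 b; simp only [Pi.add_apply, Pi.zero_apply] at this
      linear_combination this - h2 (x b) - h2 γ
    refine Submodule.mem_map.2 ⟨fun b => x b + γ, ?_, ?_⟩
    · rw [memLt]; intro i
      have e := hT i
      have hMx : (∑ j, bz (negNegOne (base.cls j)) * (x j + γ)) = (∑ j, bz (negNegOne (base.cls j)) * x j) + γ := by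
        simp only [mul_add]
        rw [Finset.sum_add_distrib, ← Finset.sum_mul, hμ, one_mul]
      rw [hMx]
      have hS : (∑ j, bz (base.neg i j) * ((x j + γ) + (x i + γ))) = ∑ j, bz (base.neg i j) * (x j + x i) :=
        Finset.sum_congr rfl fun j _ => by linear_combination (bz (base.neg i j)) * h2 γ
      rw [hS]
      linear_combination e + h2 (bz (negNegOne (base.cls i)) * γ)
    · refine Prod.ext ?_ ?_
      · funext b; simp
      · funext b; simp [hxy b]
  have hinjD : Function.Injective ((LinearMap.id : (Fin (k + 1) → ZMod 2) →ₗ[ZMod 2] (Fin (k + 1) → ZMod 2)).prod LinearMap.id) :=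
    fun a b hab => congrArg Prod.fst hab
  have b1 := (Submodule.finrank_mono hP1).trans
    (le_of_eq (LinearEquiv.finrank_eq (Submodule.equivMapOfInjective _ LinearMap.inl_injective kerL)).symm)
  have b2 := (Submodule.finrank_mono hP2).trans
    (le_of_eq (LinearEquiv.finrank_eq (Submodule.equivMapOfInjective _ LinearMap.inr_injective kerL)).symm)
  have b3 := (Submodule.finrank_mono hP3).trans
    (le_of_eq (LinearEquiv.finrank_eq (Submodule.equivMapOfInjective _ hinjD kerLt)).symm)
  rw [hrank] at b3
  exact exists_patternFree_design_of_odd base hroot δ hleg (b1.trans htτ) (b2.trans htτ) (b3.trans htτ)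

end OddNegTwoTrivial

end Summit.BirchSwinnertonDyer.BirchSwinnertonDyer.Theorems.SymbolicMonsky
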